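import Literature.MathematicalPhysics.QuantumManyBody.PeriodicWeightedMaxFormBound
import Literature.MathematicalPhysics.QuantumManyBody.PeriodicMaxFormGroundStates
import HarnessLib

/-!
# Ground states of the maximal form of `-∑ⱼΔⱼ + W` (abstract weight): the Beurling–Deny lattice

Topic `Literature/MathematicalPhysics/QuantumManyBody`, sequel of `PeriodicWeightedMaxFormBound.lean`;
abstract-weight twin of the first part of `PeriodicMaxFormGroundStates.lean` (same statements and proofs with
`periodicInteraction v L ↦ W`, `periodicGroundStateEnergy v N L ↦ periodicGroundStateEnergyW W L`, under
`hWm : Measurable W`, `hW : ∫⁻ X in cellN N L, W X ≠ ⊤`). On `H = L²((ℝ/ℤ)^{3N})` (Haar probability measure):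

  `maxFormW W L η = maxFormKin L η + maxFormPotW W L η`,  `maxFormPotW W L η = ∫ (W ∘ fromUnitTorusN L) |η|²`,
  `maxFormGroundStatesW W L = {η ∈ boseSymmetric N | maxFormW W L η ≤ E₀(W) ‖η‖²}`,

the maximal form [Simon1979Forms] and its ground-state class in the Bose sector (the kinetic part `maxFormKin`,
the Bose sector `boseSymmetric` and the lattice maps `absLp`, `conjLp`, `reLp`, `imLp`, `posPartLp`, `negPartLp`
with their `W`-independent properties are those of the pair file). **Results**: the ground-state class is a
`ℂ`-subspace (parallelogram law of the maximal form and the maximal-form bound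
`periodicGroundStateEnergyW_mul_le_maxFormW`), stable under `|·|` and complex conjugation — the Beurling–Deny /
Reed–Simon step "`|ψ|` is again a ground state" [ReedSimonIV1978, Thm XIII.43 (c)⇒(a), Thm XIII.50 (b)] — and
hence under real/imaginary/positive/negative parts of real ground states. Lower semicontinuity and the bridge to
the closed form are in `PeriodicWeightedMaxFormBridge.lean`.

## References
* [ReedSimonIV1978] Reed–Simon IV, §XIII.12, Thms XIII.43–XIII.44, XIII.48, App. 1 (Thm XIII.50).
* [FarisSimon1975] W. Faris, B. Simon, Duke Math. J. 42 (1975) 559–567.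
* [Simon1979Forms] B. Simon, J. Operator Theory 1 (1979) 37–47.
-/

noncomputable section

open MeasureTheory Filter Set WithLp Complex UnitAddTorus
open scoped ENNReal NNReal Topology ComplexConjugate InnerProductSpace
open Literature.Analysis.FunctionSpaces Literature.Analysis.OperatorTheory Literature.Analysis.InnerProduct

namespace Literature.MathematicalPhysics.QuantumManyBody.BoseGas

-- The measure on `ℝ/ℤ` is the Haar PROBABILITY measure, as in `PeriodicFormDomain.lean`.
attribute [local instance] formDomain_measureSpace formDomain_isProbabilityMeasure formDomain_isProbabilityMeasure_pi

variable {N : ℕ} {L : ℝ} {W : Config N → ℝ≥0∞}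

/-- Local notation for the Hilbert space `H = L²((ℝ/ℤ)^{3N})`. -/
local notation "L2T " N':max => Lp ℂ 2 (volume : Measure (UnitAddTorus (Fin N' × Fin 3)))

/-! ### The maximal form -/


/-- **The potential part of the maximal form**: `maxFormPotW W L η = ∫ (W ∘ fromUnitTorusN L) |η|²` (abstract weight `W`). [cite: Simon1979Forms, Thm. 2.1] -/
def maxFormPotW (W : Config N → ℝ≥0∞) (L : ℝ) (η : L2T N) : ℝ≥0∞ :=
  ∫⁻ t, W (fromUnitTorusN L t) *
    ((‖(η : UnitAddTorus (Fin N × Fin 3) → ℂ) t‖₊ : ℝ≥0∞)) ^ 2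

/-- **The maximal form** `maxFormW W L η = ∑ₙ (∑ₚ (2πnₚ/L)²) |⟪eₙ, η⟫|² + ∫ (W ∘ fromUnitTorusN L) |η|² ∈ [0, ∞]`
of the periodic `N`-body Hamiltonian `-∑ⱼΔⱼ + W` on `L²((ℝ/ℤ)^{3N})` (finite exactly on
`H¹ ∩ {∫ W|η|² < ∞}`). [cite: Simon1979Forms, Thm. 2.1] -/
def maxFormW (W : Config N → ℝ≥0∞) (L : ℝ) (η : L2T N) : ℝ≥0∞ :=
  maxFormKin L η + maxFormPotW W L η

/-- Unfolding `maxFormW`. [folklore] -/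
theorem maxFormW_def (W : Config N → ℝ≥0∞) (L : ℝ) (η : L2T N) :
    maxFormW W L η = maxFormKin L η + maxFormPotW W L η := rfl


/-- **The ground-state class of the maximal form in the Bose sector**: the Bose-symmetric classes with
`maxFormW W L η ≤ E₀ ‖η‖²`, `E₀ = periodicGroundStateEnergyW W L` — by the maximal-form bound these are the
minimisers of the Rayleigh quotient of the maximal form (together with `0`), i.e. the (variational)
ground states of `-∑ⱼΔⱼ + W` on the symmetric subspace. [cite: ReedSimonIV1978, §XIII.12] -/
def maxFormGroundStatesW (W : Config N → ℝ≥0∞) (L : ℝ) : Set (L2T N) :=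
  {η | η ∈ boseSymmetric N ∧ maxFormW W L η ≤ periodicGroundStateEnergyW W L * ENNReal.ofReal (‖η‖ ^ 2)}

/-- Membership in the ground-state class. [folklore] -/
theorem mem_maxFormGroundStatesW {η : L2T N} :
    η ∈ maxFormGroundStatesW W L ↔ η ∈ boseSymmetric N ∧
      maxFormW W L η ≤ periodicGroundStateEnergyW W L * ENNReal.ofReal (‖η‖ ^ 2) :=
  Iff.rfl

/-! ### Scaling, zero, and the maximal-form bound -/


/-- `maxFormPotW (c • η) = |c|² maxFormPotW η`. [folklore] -/
theorem maxFormPotW_smul (W : Config N → ℝ≥0∞) (L : ℝ) (c : ℂ) (η : L2T N) :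
    maxFormPotW W L (c • η) = ENNReal.ofReal (‖c‖ ^ 2) * maxFormPotW W L η :=
  lintegral_weight_smul_sq _ c η

/-- `maxFormW (c • η) = |c|² maxFormW η`. [folklore] -/
theorem maxFormW_smul (W : Config N → ℝ≥0∞) (L : ℝ) (c : ℂ) (η : L2T N) :
    maxFormW W L (c • η) = ENNReal.ofReal (‖c‖ ^ 2) * maxFormW W L η := by
  rw [maxFormW, maxFormW, maxFormKin_smul, maxFormPotW_smul, mul_add]

/-- `maxFormW 0 = 0`. [folklore] -/
theorem maxFormW_zero (W : Config N → ℝ≥0∞) (L : ℝ) : maxFormW W L (0 : L2T N) = 0 := by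
  have h := maxFormW_smul W L 0 (0 : L2T N)
  rwa [zero_smul, norm_zero, zero_pow two_ne_zero, ENNReal.ofReal_zero, zero_mul] at h

/-- **The maximal-form bound** (tree, `periodicGroundStateEnergyW_mul_le_maxFormW`): on the Bose sector
`E₀ ‖η‖² ≤ maxFormW W L η`. [cite: Simon1979Forms, Thm. 2.1] -/
theorem periodicGroundStateEnergyW_mul_le_maxFormW_of_mem (hL : 0 < L) (hWm : Measurable W)
    (hW : ∫⁻ X in cellN N L, W X ≠ ⊤) {η : L2T N} (hη : η ∈ boseSymmetric N) :
    periodicGroundStateEnergyW W L * ENNReal.ofReal (‖η‖ ^ 2) ≤ maxFormW W L η :=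
  periodicGroundStateEnergyW_mul_le_maxFormW hL hWm hW η hη

/-- On the ground-state class the bound is an equality: `maxFormW W L η = E₀ ‖η‖²`. [folklore] -/
theorem maxFormW_eq_of_mem_maxFormGroundStatesW (hL : 0 < L) (hWm : Measurable W)
    (hW : ∫⁻ X in cellN N L, W X ≠ ⊤) {η : L2T N} (hη : η ∈ maxFormGroundStatesW W L) :
    maxFormW W L η = periodicGroundStateEnergyW W L * ENNReal.ofReal (‖η‖ ^ 2) :=
  le_antisymm hη.2 (periodicGroundStateEnergyW_mul_le_maxFormW_of_mem hL hWm hW hη.1)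

/-- Ground states have finite maximal form (when `E₀ < ∞`). [folklore] -/
theorem maxFormW_ne_top_of_mem_maxFormGroundStatesW (hE : periodicGroundStateEnergyW W L ≠ ⊤) {η : L2T N}
    (hη : η ∈ maxFormGroundStatesW W L) : maxFormW W L η ≠ ⊤ :=
  ne_top_of_le_ne_top (ENNReal.mul_ne_top hE ENNReal.ofReal_ne_top) hη.2

/-- Ground states have finite kinetic energy. [folklore] -/
theorem maxFormKin_ne_top_of_mem_maxFormGroundStatesW (hE : periodicGroundStateEnergyW W L ≠ ⊤) {η : L2T N}
    (hη : η ∈ maxFormGroundStatesW W L) : maxFormKin L η ≠ ⊤ :=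
  ne_top_of_le_ne_top (maxFormW_ne_top_of_mem_maxFormGroundStatesW hE hη) (self_le_add_right _ _)

/-- Ground states have finite potential energy. [folklore] -/
theorem maxFormPotW_ne_top_of_mem_maxFormGroundStatesW (hE : periodicGroundStateEnergyW W L ≠ ⊤) {η : L2T N}
    (hη : η ∈ maxFormGroundStatesW W L) : maxFormPotW W L η ≠ ⊤ :=
  ne_top_of_le_ne_top (maxFormW_ne_top_of_mem_maxFormGroundStatesW hE hη) (self_le_add_left _ _)

/-- `0` is in the ground-state class. [folklore] -/
theorem zero_mem_maxFormGroundStatesW (W : Config N → ℝ≥0∞) (L : ℝ) : (0 : L2T N) ∈ maxFormGroundStatesW W L :=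
  ⟨(boseSymmetric N).zero_mem, by rw [maxFormW_zero]; exact bot_le⟩

/-- The ground-state class is closed under scalars. [folklore] -/
theorem smul_mem_maxFormGroundStatesW (c : ℂ) {η : L2T N} (hη : η ∈ maxFormGroundStatesW W L) :
    c • η ∈ maxFormGroundStatesW W L := by
  refine ⟨(boseSymmetric N).smul_mem c hη.1, ?_⟩
  rw [maxFormW_smul, norm_smul, mul_pow, ENNReal.ofReal_mul (sq_nonneg _), mul_left_comm]
  exact mul_le_mul' le_rfl hη.2

/-- The ground-state class is closed under negation. [folklore] -/
theorem neg_mem_maxFormGroundStatesW {η : L2T N} (hη : η ∈ maxFormGroundStatesW W L) :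
    -η ∈ maxFormGroundStatesW W L := by
  have h := smul_mem_maxFormGroundStatesW (-1 : ℂ) hη
  rwa [neg_one_smul] at h

/-! ### The parallelogram law of the maximal form: the ground-state class is a subspace -/


/-- The weight `W ∘ fromUnitTorusN L` is measurable. [folklore] -/
theorem measurable_weight_fromUnitTorusN (hWm : Measurable W) (L : ℝ) :
    Measurable fun t : UnitAddTorus (Fin N × Fin 3) => W (fromUnitTorusN L t) :=
  hWm.comp (measurable_fromUnitTorusN L)

/-- The integrand of the potential part is a.e.-measurable. [folklore] -/
theorem aemeasurable_weight_integrand (hWm : Measurable W) (L : ℝ) (η : L2T N) :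
    AEMeasurable (fun t : UnitAddTorus (Fin N × Fin 3) => W (fromUnitTorusN L t) *
      ((‖(η : UnitAddTorus (Fin N × Fin 3) → ℂ) t‖₊ : ℝ≥0∞)) ^ 2) volume :=
  ((measurable_weight_fromUnitTorusN hWm L)).aemeasurable.mul
    ((Lp.aestronglyMeasurable η).aemeasurable.nnnorm.coe_nnreal_ennreal.pow_const 2)

/-- **Parallelogram law of the potential part.** [folklore] -/
theorem maxFormPotW_parallelogram (hWm : Measurable W) (L : ℝ) (η ξ : L2T N) :
    maxFormPotW W L (η + ξ) + maxFormPotW W L (η - ξ) = 2 * maxFormPotW W L η + 2 * maxFormPotW W L ξ := by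
  unfold maxFormPotW
  rw [← lintegral_add_left' (aemeasurable_weight_integrand hWm L _),
    ← lintegral_const_mul' _ _ ENNReal.ofNat_ne_top, ← lintegral_const_mul' _ _ ENNReal.ofNat_ne_top,
    ← lintegral_add_left' ((aemeasurable_weight_integrand hWm L _).const_mul _)]
  refine lintegral_congr_ae ?_
  filter_upwards [Lp.coeFn_add η ξ, Lp.coeFn_sub η ξ] with t hadd hsub
  rw [hadd, hsub, Pi.add_apply, Pi.sub_apply, ← mul_add, coe_nnnorm_sq_parallelogram]
  ring

/-- **Parallelogram law of the maximal form.** [folklore] -/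
theorem maxFormW_parallelogram (hWm : Measurable W) (L : ℝ) (η ξ : L2T N) :
    maxFormW W L (η + ξ) + maxFormW W L (η - ξ) = 2 * maxFormW W L η + 2 * maxFormW W L ξ := by
  simp only [maxFormW]
  calc maxFormKin L (η + ξ) + maxFormPotW W L (η + ξ) + (maxFormKin L (η - ξ) + maxFormPotW W L (η - ξ))
      = (maxFormKin L (η + ξ) + maxFormKin L (η - ξ)) + (maxFormPotW W L (η + ξ) + maxFormPotW W L (η - ξ)) := by
        ring
    _ = _ := by rw [maxFormKin_parallelogram, maxFormPotW_parallelogram hWm]; ring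

/-- **The ground-state class is closed under addition** (`E₀ < ∞`): by the parallelogram law
`maxFormW(η+ξ) + maxFormW(η-ξ) = 2E₀‖η‖² + 2E₀‖ξ‖² = E₀‖η+ξ‖² + E₀‖η-ξ‖²`, and `maxFormW(η-ξ) ≥ E₀‖η-ξ‖²`.
[folklore] -/
theorem add_mem_maxFormGroundStatesW (hL : 0 < L) (hWm : Measurable W)
    (hW : ∫⁻ X in cellN N L, W X ≠ ⊤) (hE : periodicGroundStateEnergyW W L ≠ ⊤)
    {η ξ : L2T N} (hη : η ∈ maxFormGroundStatesW W L) (hξ : ξ ∈ maxFormGroundStatesW W L) :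
    η + ξ ∈ maxFormGroundStatesW W L := by
  set E := periodicGroundStateEnergyW W L with hEdef
  refine ⟨(boseSymmetric N).add_mem hη.1 hξ.1, ?_⟩
  have hlow : E * ENNReal.ofReal (‖η - ξ‖ ^ 2) ≤ maxFormW W L (η - ξ) :=
    periodicGroundStateEnergyW_mul_le_maxFormW_of_mem hL hWm hW ((boseSymmetric N).sub_mem hη.1 hξ.1)
  have hsum : maxFormW W L (η + ξ) + maxFormW W L (η - ξ) ≤
      E * ENNReal.ofReal (‖η + ξ‖ ^ 2) + E * ENNReal.ofReal (‖η - ξ‖ ^ 2) := by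
    rw [maxFormW_parallelogram hWm]
    calc 2 * maxFormW W L η + 2 * maxFormW W L ξ
        ≤ 2 * (E * ENNReal.ofReal (‖η‖ ^ 2)) + 2 * (E * ENNReal.ofReal (‖ξ‖ ^ 2)) := by
          gcongr
          · exact hη.2
          · exact hξ.2
      _ = E * ENNReal.ofReal (2 * ‖η‖ ^ 2 + 2 * ‖ξ‖ ^ 2) := by
          rw [ENNReal.ofReal_add (by positivity) (by positivity), ENNReal.ofReal_mul zero_le_two,
            ENNReal.ofReal_mul zero_le_two, ENNReal.ofReal_ofNat]
          ring
      _ = E * ENNReal.ofReal (‖η + ξ‖ ^ 2 + ‖η - ξ‖ ^ 2) := by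
          congr 1
          congr 1
          have h := parallelogram_law_with_norm ℂ η ξ
          simp only [sq]
          linarith [h]
      _ = E * ENNReal.ofReal (‖η + ξ‖ ^ 2) + E * ENNReal.ofReal (‖η - ξ‖ ^ 2) := by
          rw [ENNReal.ofReal_add (sq_nonneg _) (sq_nonneg _), mul_add]
  have hfin : E * ENNReal.ofReal (‖η - ξ‖ ^ 2) ≠ ⊤ := ENNReal.mul_ne_top hE ENNReal.ofReal_ne_top
  calc maxFormW W L (η + ξ)
      = maxFormW W L (η + ξ) + E * ENNReal.ofReal (‖η - ξ‖ ^ 2) - E * ENNReal.ofReal (‖η - ξ‖ ^ 2) :=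
        (ENNReal.add_sub_cancel_right hfin).symm
    _ ≤ maxFormW W L (η + ξ) + maxFormW W L (η - ξ) - E * ENNReal.ofReal (‖η - ξ‖ ^ 2) :=
        tsub_le_tsub_right (add_le_add le_rfl hlow) _
    _ ≤ E * ENNReal.ofReal (‖η + ξ‖ ^ 2) + E * ENNReal.ofReal (‖η - ξ‖ ^ 2) - E * ENNReal.ofReal (‖η - ξ‖ ^ 2) :=
        tsub_le_tsub_right hsum _
    _ = E * ENNReal.ofReal (‖η + ξ‖ ^ 2) := ENNReal.add_sub_cancel_right hfin

/-- The ground-state class is closed under subtraction. [folklore] -/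
theorem sub_mem_maxFormGroundStatesW (hL : 0 < L) (hWm : Measurable W)
    (hW : ∫⁻ X in cellN N L, W X ≠ ⊤) (hE : periodicGroundStateEnergyW W L ≠ ⊤)
    {η ξ : L2T N} (hη : η ∈ maxFormGroundStatesW W L) (hξ : ξ ∈ maxFormGroundStatesW W L) :
    η - ξ ∈ maxFormGroundStatesW W L := by
  rw [sub_eq_add_neg]
  exact add_mem_maxFormGroundStatesW hL hWm hW hE hη (neg_mem_maxFormGroundStatesW hξ)

/-! ### Lipschitz maps of the values: the Beurling–Deny lattice operations -/


section Lipschitz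

variable {Φ : ℂ → ℂ} {K : ℝ≥0}


/-- Maps of the values that do not increase moduli do not increase the potential part. [folklore] -/
theorem maxFormPotW_compLp_le (hΦ : LipschitzWith K Φ) (h0 : Φ 0 = 0) (hle : ∀ z, ‖Φ z‖ ≤ ‖z‖) (η : L2T N) :
    maxFormPotW W L (hΦ.compLp h0 η) ≤ maxFormPotW W L η := by
  refine lintegral_mono_ae ((hΦ.coeFn_compLp h0 η).mono fun t ht => ?_)
  rw [ht, Function.comp_apply]
  gcongr
  exact hle _

/-- Maps of the values that preserve moduli preserve the potential part. [folklore] -/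
theorem maxFormPotW_compLp_eq (hΦ : LipschitzWith K Φ) (h0 : Φ 0 = 0) (heq : ∀ z, ‖Φ z‖ = ‖z‖) (η : L2T N) :
    maxFormPotW W L (hΦ.compLp h0 η) = maxFormPotW W L η := by
  refine lintegral_congr_ae ((hΦ.coeFn_compLp h0 η).mono fun t ht => ?_)
  dsimp only
  rw [ht, Function.comp_apply, ← enorm_eq_nnnorm, ← enorm_eq_nnnorm, ← ofReal_norm, ← ofReal_norm, heq]


/-- **Beurling–Deny at the level of the maximal form**: a `1`-Lipschitz map of the values fixing `0` and
preserving moduli (`|·|`, complex conjugation) maps ground states to ground states. [cite: ReedSimonIV1978, Thm XIII.43 (c)⇒(a) and Thm XIII.50 (b)] -/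
theorem compLp_mem_maxFormGroundStatesW (hΦ : LipschitzWith 1 Φ) (h0 : Φ 0 = 0) (heq : ∀ z, ‖Φ z‖ = ‖z‖)
    {η : L2T N} (hη : η ∈ maxFormGroundStatesW W L) : (hΦ.compLp h0 η : L2T N) ∈ maxFormGroundStatesW W L := by
  refine ⟨compLp_mem_boseSymmetric hΦ h0 hη.1, ?_⟩
  rw [norm_compLp_eq hΦ h0 heq, maxFormW, maxFormPotW_compLp_eq hΦ h0 heq]
  exact (add_le_add (maxFormKin_compLp_le_of_one hΦ h0 η) le_rfl).trans hη.2

end Lipschitz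

/-! ### The lattice maps `|η|`, `conj η`, `re η`, `im η`, `η⁺`, `η⁻` on `L²` -/


/-- **`|η|` is a ground state if `η` is.** [cite: ReedSimonIV1978, Thm XIII.43 (c)⇒(a)] -/
theorem absLp_mem_maxFormGroundStatesW {η : L2T N} (hη : η ∈ maxFormGroundStatesW W L) :
    absLp η ∈ maxFormGroundStatesW W L :=
  compLp_mem_maxFormGroundStatesW _ _ (fun z => by simp) hη

/-- **`conj η` is a ground state if `η` is** (the form is real). [cite: ReedSimonIV1978, Thm XIII.43] -/
theorem conjLp_mem_maxFormGroundStatesW {η : L2T N} (hη : η ∈ maxFormGroundStatesW W L) :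
    conjLp η ∈ maxFormGroundStatesW W L :=
  compLp_mem_maxFormGroundStatesW _ _ (fun z => by simp) hη


/-- **Real and imaginary parts of ground states are ground states** (`E₀ < ∞`). [cite: ReedSimonIV1978, Thm XIII.43] -/
theorem reLp_mem_maxFormGroundStatesW (hL : 0 < L) (hWm : Measurable W)
    (hW : ∫⁻ X in cellN N L, W X ≠ ⊤) (hE : periodicGroundStateEnergyW W L ≠ ⊤)
    {η : L2T N} (hη : η ∈ maxFormGroundStatesW W L) : reLp η ∈ maxFormGroundStatesW W L := by
  rw [reLp_eq]
  exact smul_mem_maxFormGroundStatesW _ (add_mem_maxFormGroundStatesW hL hWm hW hE hη (conjLp_mem_maxFormGroundStatesW hη))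

/-- Imaginary parts of ground states are ground states (`E₀ < ∞`). [cite: ReedSimonIV1978, Thm XIII.43] -/
theorem imLp_mem_maxFormGroundStatesW (hL : 0 < L) (hWm : Measurable W)
    (hW : ∫⁻ X in cellN N L, W X ≠ ⊤) (hE : periodicGroundStateEnergyW W L ≠ ⊤)
    {η : L2T N} (hη : η ∈ maxFormGroundStatesW W L) : imLp η ∈ maxFormGroundStatesW W L := by
  rw [imLp_eq]
  exact smul_mem_maxFormGroundStatesW _ (sub_mem_maxFormGroundStatesW hL hWm hW hE hη (conjLp_mem_maxFormGroundStatesW hη))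

/-- **Positive parts of REAL ground states are ground states** (`E₀ < ∞`): `η⁺ = ½(|η| + η)`.
[cite: ReedSimonIV1978, Thm XIII.43 (c)⇒(a)] -/
theorem posPartLp_mem_maxFormGroundStatesW (hL : 0 < L) (hWm : Measurable W)
    (hW : ∫⁻ X in cellN N L, W X ≠ ⊤) (hE : periodicGroundStateEnergyW W L ≠ ⊤)
    {η : L2T N} (hη : η ∈ maxFormGroundStatesW W L) (hreal : conjLp η = η) :
    posPartLp η ∈ maxFormGroundStatesW W L := by
  rw [posPartLp_eq_of_conjLp_eq hreal]
  exact smul_mem_maxFormGroundStatesW _ (add_mem_maxFormGroundStatesW hL hWm hW hE (absLp_mem_maxFormGroundStatesW hη) hη)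

/-- Negative parts of REAL ground states are ground states (`E₀ < ∞`): `η⁻ = ½(|η| - η)`.
[cite: ReedSimonIV1978, Thm XIII.43 (c)⇒(a)] -/
theorem negPartLp_mem_maxFormGroundStatesW (hL : 0 < L) (hWm : Measurable W)
    (hW : ∫⁻ X in cellN N L, W X ≠ ⊤) (hE : periodicGroundStateEnergyW W L ≠ ⊤)
    {η : L2T N} (hη : η ∈ maxFormGroundStatesW W L) (hreal : conjLp η = η) :
    negPartLp η ∈ maxFormGroundStatesW W L := by
  rw [negPartLp_eq_of_conjLp_eq hreal]
  exact smul_mem_maxFormGroundStatesW _ (sub_mem_maxFormGroundStatesW hL hWm hW hE (absLp_mem_maxFormGroundStatesW hη) hη)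

end Literature.MathematicalPhysics.QuantumManyBody.BoseGas

end
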